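import Summits.Ventures.Crystal3D.Theorems.StickyWulffConstantNoReconstructionGainCellFluxGlue
import Summits.Ventures.Crystal3D.StickySpheres.FinsetBridge
import HarnessLib

/-!
# Dissolution glue for the blanket bound: removing SETS of balls

HONEST FRAMING. Part of the venture `Summits/Ventures/Crystal3D` (cell `crystal3d-full`), helper
`--supports` the crux `NoReconstructionGain` (stmt-Ventures-19144, route
`route-Ventures-StickyWulffConstant`), line `adhesion`; companion of cf-p1 g14's BLANKET line
(`lines/blanket/Blanket.lean`: `BlanketBound`, `DissolutionStep`, target `BlanketOfDissolution`) and
of cf-p2's R27 (Conjecture D refuted by the 22-ball oblique hcp rod; repair = pair / set steps `D₂`).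

The blanket bound `2√3 · S_ν(X; r) ≤ D(X)` is proved by DISSOLUTION whenever every non-empty packing
(of a class closed under the removals used) contains a non-empty SET `T` of balls whose joint removal
loses at least as much deficiency as `2√3 ×` the shadow it alone carries:

  `4√3 · e_ν(T; X) ≤ Σ_{t ∈ T} (12 − 2 deg_X t) + #{(t, t') ∈ T × T : dist = 1}`,

`e_ν(T; X)` = area of the part of the shadow covered by discs of `T` and by no disc of `X ∖ T`.  This
file proves that glue, by strong induction on `#X`, in the Finset vocabulary of the line's atom
(`pointBlanket_of_setDissolution`, with an arbitrary removal-closed class `𝒞`), and derives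

* `blanketBound_of_setDissolution` — cf-p1's landed `CellFlux.BlanketBound` (labelled packings)
  from the set-step hypothesis at every unit normal;
* `blanket_of_dissolutionStep` — cf-p1 g14's target `BlanketOfDissolution` BY CONTENT, def-free
  (`DissolutionStep` — one ball at a time — unfolded): the special case `T = {one ball}`.

Only SUB-additivity of the shadow (`shadow X ⊆ shadow (X ∖ T) ∪ exclusive(T)`) and the exact
bookkeeping of contacts under removal (`contactDeficiency_eq_sdiff_add`) are used — no measurability
or disjointness.

WHAT THIS IS NOT: no dissolution step is proved here (cf-p2 R27: the one-ball step `DissolutionStep`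
is FALSE — rod22, slack `4 − 3√2`; the pair step `D₂` and whole-layer steps are uncensused /
unproved); the blanket bound stays a conjecture; rung F-C1 not moved.
-/

noncomputable section

namespace Summit.Ventures.Crystal3D.Theorems

open Summit.Ventures.Crystal3D Finset MeasureTheory
open Summit.Ventures.Crystal3D.Cruxes.NoReconstructionGain.CellFlux (lateralSq shadowSlab shadowArea
  blanketRadius BlanketBound)
open Literature.MathematicalPhysics.StatisticalMechanics (orderedContacts contactDeficiency)
open scoped InnerProductSpace

/-! ### 1. Bookkeeping of contacts under removal of a set -/

/-- Ordered contact pairs between `A` and `B`, counted fibrewise. -/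
theorem card_filter_product_dist_eq_sum (A B : Finset (EuclideanSpace ℝ (Fin 3))) :
    (((A ×ˢ B).filter fun p => dist p.1 p.2 = 1).card : ℝ) =
      ∑ a ∈ A, ((B.filter fun q => dist a q = 1).card : ℝ) := by
  classical
  rw [card_filter, sum_product]
  push_cast
  refine sum_congr rfl fun a _ => ?_
  rw [card_filter]
  push_cast
  rfl

/-- Splitting a fibre count along `X = (X ∖ T) ∪ T`. -/
theorem card_filter_dist_eq_sdiff_add (X T : Finset (EuclideanSpace ℝ (Fin 3))) (hT : T ⊆ X)
    (a : EuclideanSpace ℝ (Fin 3)) :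
    ((X.filter fun q => dist a q = 1).card : ℝ) =
      (((X \ T).filter fun q => dist a q = 1).card : ℝ) + ((T.filter fun q => dist a q = 1).card : ℝ) := by
  classical
  rw [card_filter, card_filter, card_filter]
  push_cast
  rw [← sum_sdiff hT]

/-- Symmetry of the cross count. -/
theorem sum_card_filter_dist_comm (A B : Finset (EuclideanSpace ℝ (Fin 3))) :
    ∑ a ∈ A, ((B.filter fun q => dist a q = 1).card : ℝ) =
      ∑ b ∈ B, ((A.filter fun q => dist b q = 1).card : ℝ) := by
  classical
  simp only [card_filter]
  push_cast
  rw [sum_comm]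
  refine sum_congr rfl fun b _ => sum_congr rfl fun a _ => ?_
  rw [dist_comm]

/-- **Contacts under removal of a set.**  For `T ⊆ X`:
`D(X) = D(X ∖ T) + Σ_{t ∈ T} (6 − deg_X t) + ½ #{(t,t') ∈ T × T : dist = 1}`. -/
theorem contactDeficiency_eq_sdiff_add (X T : Finset (EuclideanSpace ℝ (Fin 3))) (hT : T ⊆ X) :
    contactDeficiency X = contactDeficiency (X \ T) +
      ∑ t ∈ T, (6 - ((X.filter fun q => dist t q = 1).card : ℝ)) + (orderedContacts T : ℝ) / 2 := by
  classical
  unfold contactDeficiency orderedContacts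
  rw [card_filter_product_dist_eq_sum, card_filter_product_dist_eq_sum,
    card_filter_product_dist_eq_sum]
  have hcard : ((X \ T).card : ℝ) = (X.card : ℝ) - (T.card : ℝ) := by
    rw [card_sdiff_of_subset hT, Nat.cast_sub (card_le_card hT)]
  -- split the outer sum over `X = (X \ T) ∪ T` and every fibre likewise
  have hsplit : ∑ a ∈ X, ((X.filter fun q => dist a q = 1).card : ℝ) =
      ∑ a ∈ X \ T, (((X \ T).filter fun q => dist a q = 1).card : ℝ) +
        2 * ∑ t ∈ T, (((X \ T).filter fun q => dist t q = 1).card : ℝ) +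
        ∑ t ∈ T, ((T.filter fun q => dist t q = 1).card : ℝ) := by
    rw [← sum_sdiff hT]
    rw [sum_congr rfl fun a _ => card_filter_dist_eq_sdiff_add X T hT a,
      sum_congr rfl fun a (_ : a ∈ T) => card_filter_dist_eq_sdiff_add X T hT a,
      sum_add_distrib, sum_add_distrib, sum_card_filter_dist_comm (X \ T) T]
    ring
  have hT' : ∑ t ∈ T, (6 - ((X.filter fun q => dist t q = 1).card : ℝ)) =
      6 * (T.card : ℝ) - (∑ t ∈ T, (((X \ T).filter fun q => dist t q = 1).card : ℝ) +
        ∑ t ∈ T, ((T.filter fun q => dist t q = 1).card : ℝ)) := by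
    rw [sum_congr rfl fun t (_ : t ∈ T) =>
        show (6 - ((X.filter fun q => dist t q = 1).card : ℝ)) =
          6 - ((((X \ T).filter fun q => dist t q = 1).card : ℝ) +
            ((T.filter fun q => dist t q = 1).card : ℝ)) by
        rw [card_filter_dist_eq_sdiff_add X T hT t],
      sum_sub_distrib, sum_const, nsmul_eq_mul, sum_add_distrib]
    ring
  rw [hsplit, hT', hcard]
  ring

/-! ### 2. The shadow is sub-additive under removal -/

/-- The shadow of a finite point set is bounded. -/
theorem pointShadow_subset_closedBall (ν : EuclideanSpace ℝ (Fin 3)) (hν : ‖ν‖ = 1) (r : ℝ)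
    (X : Finset (EuclideanSpace ℝ (Fin 3))) :
    {y : EuclideanSpace ℝ (Fin 3) | (∃ p ∈ X, lateralSq ν p y ≤ r ^ 2) ∧ |⟪y, ν⟫_ℝ| ≤ 1 / 2} ⊆
      Metric.closedBall (0 : EuclideanSpace ℝ (Fin 3)) (2 * ∑ p ∈ X, ‖p‖ + |r| + 1 / 2) := by
  rintro y ⟨⟨p, hp, hL⟩, hy⟩
  have h := lateral_slab_subset_closedBall ν hν r (fun _ : Fin 1 => p) 0 ⟨hL, hy⟩
  rw [Metric.mem_closedBall] at h ⊢
  have hs : ∑ _m : Fin 1, ‖p‖ = ‖p‖ := by simp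
  rw [hs] at h
  have hle : ‖p‖ ≤ ∑ q ∈ X, ‖q‖ := single_le_sum (fun q _ => norm_nonneg q) hp
  linarith

/-- Hence its volume is finite. -/
theorem volume_pointShadow_ne_top (ν : EuclideanSpace ℝ (Fin 3)) (hν : ‖ν‖ = 1) (r : ℝ)
    (X : Finset (EuclideanSpace ℝ (Fin 3))) :
    volume {y : EuclideanSpace ℝ (Fin 3) | (∃ p ∈ X, lateralSq ν p y ≤ r ^ 2) ∧ |⟪y, ν⟫_ℝ| ≤ 1 / 2}
      ≠ ⊤ :=
  (lt_of_le_of_lt (measure_mono (pointShadow_subset_closedBall ν hν r X))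
    measure_closedBall_lt_top).ne

/-- **Sub-additivity.**  The shadow of `X` is covered by the shadow of `X ∖ T` and the part covered
by `T`-discs only. -/
theorem pointShadow_subset_union (ν : EuclideanSpace ℝ (Fin 3)) (r : ℝ)
    (X T : Finset (EuclideanSpace ℝ (Fin 3))) :
    {y : EuclideanSpace ℝ (Fin 3) | (∃ p ∈ X, lateralSq ν p y ≤ r ^ 2) ∧ |⟪y, ν⟫_ℝ| ≤ 1 / 2} ⊆
      {y | (∃ p ∈ X \ T, lateralSq ν p y ≤ r ^ 2) ∧ |⟪y, ν⟫_ℝ| ≤ 1 / 2} ∪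
      {y | (∃ p ∈ T, lateralSq ν p y ≤ r ^ 2) ∧ (∀ q ∈ X \ T, r ^ 2 < lateralSq ν q y) ∧
        |⟪y, ν⟫_ℝ| ≤ 1 / 2} := by
  classical
  rintro y ⟨⟨p, hp, hL⟩, hy⟩
  by_cases h : ∃ q ∈ X \ T, lateralSq ν q y ≤ r ^ 2
  · exact Or.inl ⟨h, hy⟩
  · push Not at h
    have hpT : p ∈ T := by
      by_contra hpT
      exact absurd hL (not_le.2 (h p (mem_sdiff.2 ⟨hp, hpT⟩)))
    exact Or.inr ⟨⟨p, hpT, hL⟩, h, hy⟩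

/-! ### 3. The glue -/

/-- **Blanket bound by set dissolution** (Finset form, one normal, any radius, any removal-closed
class `𝒞`).  If every non-empty finite unit packing `X` in `𝒞` has a non-empty `T ⊆ X` with
`X ∖ T ∈ 𝒞` and `4√3 · e_ν(T; X) ≤ Σ_{t∈T} (12 − 2 deg_X t) + #{(t,t') ∈ T² : dist = 1}`, then
`2√3 · S_ν(X; r) ≤ contactDeficiency X` for every finite unit packing `X ∈ 𝒞`. -/
theorem pointBlanket_of_setDissolution (ν : EuclideanSpace ℝ (Fin 3)) (hν : ‖ν‖ = 1) (r : ℝ)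
    (𝒞 : Finset (EuclideanSpace ℝ (Fin 3)) → Prop)
    (H : ∀ X : Finset (EuclideanSpace ℝ (Fin 3)), 𝒞 X →
      (∀ p ∈ X, ∀ q ∈ X, p ≠ q → 1 ≤ dist p q) → X.Nonempty →
      ∃ T ⊆ X, T.Nonempty ∧ 𝒞 (X \ T) ∧
        4 * Real.sqrt 3 * (volume {y : EuclideanSpace ℝ (Fin 3) |
            (∃ p ∈ T, lateralSq ν p y ≤ r ^ 2) ∧ (∀ q ∈ X \ T, r ^ 2 < lateralSq ν q y) ∧
            |⟪y, ν⟫_ℝ| ≤ 1 / 2}).toReal ≤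
          ∑ t ∈ T, (12 - 2 * ((X.filter fun q => dist t q = 1).card : ℝ)) +
            (orderedContacts T : ℝ)) :
    ∀ X : Finset (EuclideanSpace ℝ (Fin 3)), 𝒞 X → (∀ p ∈ X, ∀ q ∈ X, p ≠ q → 1 ≤ dist p q) →
      2 * Real.sqrt 3 * (volume {y : EuclideanSpace ℝ (Fin 3) |
          (∃ p ∈ X, lateralSq ν p y ≤ r ^ 2) ∧ |⟪y, ν⟫_ℝ| ≤ 1 / 2}).toReal ≤
        contactDeficiency X := by
  classical
  intro X
  induction X using Finset.strongInduction with
  | H X ih =>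
    intro hC hX
    rcases X.eq_empty_or_nonempty with hXe | hXne
    · subst hXe
      have hset : {y : EuclideanSpace ℝ (Fin 3) |
          (∃ p ∈ (∅ : Finset (EuclideanSpace ℝ (Fin 3))), lateralSq ν p y ≤ r ^ 2) ∧
            |⟪y, ν⟫_ℝ| ≤ 1 / 2} = ∅ := by
        ext y; simp
      rw [hset, measure_empty, ENNReal.toReal_zero, mul_zero]
      unfold contactDeficiency orderedContacts
      simp
    obtain ⟨T, hTX, hTne, hCT, hstep⟩ := H X hC hX hXne
    have hsub : X \ T ⊂ X := sdiff_ssubset hTX hTne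
    have hY : ∀ p ∈ X \ T, ∀ q ∈ X \ T, p ≠ q → 1 ≤ dist p q :=
      fun p hp q hq hpq => hX p (sdiff_subset hp) q (sdiff_subset hq) hpq
    have hIH := ih (X \ T) hsub hCT hY
    -- sub-additivity of the volumes
    have hfinY := volume_pointShadow_ne_top ν hν r (X \ T)
    have hfinE : volume {y : EuclideanSpace ℝ (Fin 3) | (∃ p ∈ T, lateralSq ν p y ≤ r ^ 2) ∧
        (∀ q ∈ X \ T, r ^ 2 < lateralSq ν q y) ∧ |⟪y, ν⟫_ℝ| ≤ 1 / 2} ≠ ⊤ := by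
      refine (lt_of_le_of_lt (measure_mono ?_)
        (lt_top_iff_ne_top.2 (volume_pointShadow_ne_top ν hν r T))).ne
      rintro y ⟨hp, -, hy⟩; exact ⟨hp, hy⟩
    have hvol := le_trans (measure_mono (pointShadow_subset_union ν r X T))
      (measure_union_le (μ := volume) _ _)
    have hvol' := ENNReal.toReal_mono (ENNReal.add_ne_top.2 ⟨hfinY, hfinE⟩) hvol
    rw [ENNReal.toReal_add hfinY hfinE] at hvol'
    -- bookkeeping of contacts
    have hD := contactDeficiency_eq_sdiff_add X T hTX
    have hsum : ∑ t ∈ T, (12 - 2 * ((X.filter fun q => dist t q = 1).card : ℝ)) =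
        2 * ∑ t ∈ T, (6 - ((X.filter fun q => dist t q = 1).card : ℝ)) := by
      rw [mul_sum]; refine sum_congr rfl fun t _ => ?_; ring
    rw [hsum] at hstep
    have h3 : 0 ≤ Real.sqrt 3 := Real.sqrt_nonneg 3
    nlinarith [hvol', hIH, hstep, hD, h3]

/-- **`BlanketBound` by set dissolution.**  If at every unit normal every non-empty finite unit
packing admits a removable set as above (radius `1/√3`), then cf-p1's blanket bound holds for every
labelled unit packing. -/
theorem blanketBound_of_setDissolution :
    (∀ ν : EuclideanSpace ℝ (Fin 3), ‖ν‖ = 1 → ∀ X : Finset (EuclideanSpace ℝ (Fin 3)),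
      (∀ p ∈ X, ∀ q ∈ X, p ≠ q → 1 ≤ dist p q) → X.Nonempty →
      ∃ T ⊆ X, T.Nonempty ∧
        4 * Real.sqrt 3 * (MeasureTheory.volume {y : EuclideanSpace ℝ (Fin 3) |
            (∃ p ∈ T, Summit.Ventures.Crystal3D.Cruxes.NoReconstructionGain.CellFlux.lateralSq ν p y ≤
              Summit.Ventures.Crystal3D.Cruxes.NoReconstructionGain.CellFlux.blanketRadius ^ 2) ∧
            (∀ q ∈ X \ T, Summit.Ventures.Crystal3D.Cruxes.NoReconstructionGain.CellFlux.blanketRadius ^ 2 <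
              Summit.Ventures.Crystal3D.Cruxes.NoReconstructionGain.CellFlux.lateralSq ν q y) ∧
            |⟪y, ν⟫_ℝ| ≤ 1 / 2}).toReal ≤
          ∑ t ∈ T, (12 - 2 * ((X.filter fun q => dist t q = 1).card : ℝ)) +
            (Literature.MathematicalPhysics.StatisticalMechanics.orderedContacts T : ℝ)) →
    Summit.Ventures.Crystal3D.Cruxes.NoReconstructionGain.CellFlux.BlanketBound := by
  classical
  intro H N x hx ν hν
  have hinj : Function.Injective x := hx.injective
  set X := univ.image x with hXdef
  have hXp : ∀ p ∈ X, ∀ q ∈ X, p ≠ q → 1 ≤ dist p q := by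
    intro p hp q hq hpq
    obtain ⟨i, -, rfl⟩ := mem_image.1 hp
    obtain ⟨j, -, rfl⟩ := mem_image.1 hq
    exact hx fun e => hpq (by rw [e])
  have hmain := pointBlanket_of_setDissolution ν hν blanketRadius (fun _ => True)
    (fun X _ hX hne => by
      obtain ⟨T, hTX, hTne, h⟩ := H ν hν X hX hne
      exact ⟨T, hTX, hTne, trivial, h⟩) X trivial hXp
  rw [hXdef, contactDeficiency_image_eq x hinj] at hmain
  have hset : shadowSlab ν blanketRadius x = {y : EuclideanSpace ℝ (Fin 3) |
      (∃ p ∈ univ.image x, lateralSq ν p y ≤ blanketRadius ^ 2) ∧ |⟪y, ν⟫_ℝ| ≤ 1 / 2} := by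
    ext y
    simp only [shadowSlab, Set.mem_setOf_eq, mem_image, mem_univ, true_and, exists_exists_eq_and]
  unfold shadowArea
  rw [hset]
  exact hmain

/-- **`BlanketOfDissolution`** (cf-p1 g14's glue target, def-free: `DissolutionStep → BlanketBound`
with `DissolutionStep` and `exclusiveArea` unfolded): if every unit packing of `N + 1` balls has, at
every unit normal, a ball `t` with `4√3 · e_ν(t) ≤ 12 − 2 deg t`, then the blanket bound holds.
(The hypothesis is FALSE — cf-p2 R27, rod22 — so this is the `T = {t}` instance of the set glue,
recorded for the line's bookkeeping; the set / pair forms are the live ones.) -/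
theorem blanket_of_dissolutionStep :
    (∀ (N : ℕ) (x : Fin (N + 1) → EuclideanSpace ℝ (Fin 3)), Summit.Ventures.Crystal3D.IsUnitPacking x →
      ∀ ν : EuclideanSpace ℝ (Fin 3), ‖ν‖ = 1 →
        ∃ t : Fin (N + 1),
          4 * Real.sqrt 3 * (MeasureTheory.volume {y : EuclideanSpace ℝ (Fin 3) |
              Summit.Ventures.Crystal3D.Cruxes.NoReconstructionGain.CellFlux.lateralSq ν (x t) y ≤
                Summit.Ventures.Crystal3D.Cruxes.NoReconstructionGain.CellFlux.blanketRadius ^ 2 ∧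
              (∀ j, j ≠ t → Summit.Ventures.Crystal3D.Cruxes.NoReconstructionGain.CellFlux.blanketRadius ^ 2 <
                Summit.Ventures.Crystal3D.Cruxes.NoReconstructionGain.CellFlux.lateralSq ν (x j) y) ∧
              |⟪y, ν⟫_ℝ| ≤ 1 / 2}).toReal ≤
            12 - 2 * (Summit.Ventures.Crystal3D.coordination x t : ℝ)) →
    Summit.Ventures.Crystal3D.Cruxes.NoReconstructionGain.CellFlux.BlanketBound := by
  classical
  intro H
  refine blanketBound_of_setDissolution fun ν hν X hX hne => ?_
  -- enumerate `X` as a labelled packing of `N + 1` balls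
  obtain ⟨N, hN⟩ : ∃ N, X.card = N + 1 := ⟨X.card - 1, (Nat.succ_pred_eq_of_pos (card_pos.2 hne)).symm⟩
  set e : Fin (N + 1) ≃ X := (Fintype.equivFinOfCardEq (by rw [Fintype.card_coe, hN])).symm with he
  set x : Fin (N + 1) → EuclideanSpace ℝ (Fin 3) := fun i => (e i : EuclideanSpace ℝ (Fin 3)) with hxdef
  have hxmem : ∀ i, x i ∈ X := fun i => (e i).2
  have hxinj : Function.Injective x := fun i j h => e.injective (Subtype.ext h)
  have hxsurj : ∀ p ∈ X, ∃ i, x i = p := fun p hp =>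
    ⟨e.symm ⟨p, hp⟩, by simp [hxdef]⟩
  have hx : IsUnitPacking x := fun i j hij => hX _ (hxmem i) _ (hxmem j) fun h => hij (hxinj h)
  obtain ⟨t, ht⟩ := H N x hx ν hν
  refine ⟨{x t}, by simpa using hxmem t, singleton_nonempty _, ?_⟩
  -- the exclusive shadow of `{x t}` is the one in the hypothesis
  have hset : {y : EuclideanSpace ℝ (Fin 3) | (∃ p ∈ ({x t} : Finset (EuclideanSpace ℝ (Fin 3))),
        lateralSq ν p y ≤ blanketRadius ^ 2) ∧
      (∀ q ∈ X \ {x t}, blanketRadius ^ 2 < lateralSq ν q y) ∧ |⟪y, ν⟫_ℝ| ≤ 1 / 2} =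
      {y | lateralSq ν (x t) y ≤ blanketRadius ^ 2 ∧
        (∀ j, j ≠ t → blanketRadius ^ 2 < lateralSq ν (x j) y) ∧ |⟪y, ν⟫_ℝ| ≤ 1 / 2} := by
    ext y
    simp only [Set.mem_setOf_eq, mem_singleton, exists_eq_left, mem_sdiff]
    constructor
    · rintro ⟨h1, h2, h3⟩
      exact ⟨h1, fun j hj => h2 (x j) ⟨hxmem j, fun h => hj (hxinj h)⟩, h3⟩
    · rintro ⟨h1, h2, h3⟩
      refine ⟨h1, fun q hq => ?_, h3⟩
      obtain ⟨j, rfl⟩ := hxsurj q hq.1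
      exact h2 j fun h => hq.2 (by rw [h])
  -- the degree of `x t` in `X` is its coordination
  have hdeg : ((X.filter fun q => dist (x t) q = 1).card : ℝ) = (coordination x t : ℝ) := by
    congr 1
    rw [coordination, contactNeighbors]
    have himg : (X.filter fun q => dist (x t) q = 1) =
        ((univ.filter fun j => j ≠ t ∧ dist (x t) (x j) = 1).image x) := by
      ext q
      simp only [mem_filter, mem_image, mem_univ, true_and]
      constructor
      · rintro ⟨hq, hd⟩
        obtain ⟨j, rfl⟩ := hxsurj q hq
        refine ⟨j, ⟨fun h => ?_, hd⟩, rfl⟩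
        rw [h, dist_self] at hd; exact absurd hd (by norm_num)
      · rintro ⟨j, ⟨-, hd⟩, rfl⟩
        exact ⟨hxmem j, hd⟩
    rw [himg, card_image_of_injective _ hxinj]
  have hoc : orderedContacts ({x t} : Finset (EuclideanSpace ℝ (Fin 3))) = 0 := by
    unfold orderedContacts
    rw [card_eq_zero, filter_eq_empty_iff]
    intro p hp
    rw [singleton_product_singleton, mem_singleton] at hp
    rw [hp, dist_self]; norm_num
  rw [hset, sum_singleton, hdeg, hoc]
  push_cast
  linarith

end Summit.Ventures.Crystal3D.Theorems
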